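import Literature.Computability.Complexity.GateEliminationCase6Vars

/-!
# Gate elimination: newly troubled gates when no ∧-type gate is fed by two variables

From Case 6 on, Li–Yang's proof of Thm. 4.1 (ECCC TR21-023, §4.1, p. 28) works under "no
∧-type gate is directly fed by two variables" and with no troubled gate. Then an elimination can
create a troubled gate only in one way: the troubled gate read the eliminated gate, the
replacement node is a variable, and its other wire was already a variable (a troubled gate is an
∧-type gate fed by two variables; if it did not read the eliminated gate its wires are unchanged).
This is the combinatorial content of Case 6.2 ("To produce potential increment, `R` is either an
∧-type gate or a variable"; Case 6.2.1: an ∧-type `R` cannot become troubled — here simply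
because it would be fed by two variables; Case 6.2.2: "`R = u` is a variable … `B` is an ∧-type
gate fed by `P` and a variable `t`"). PROVED here, for any exact elimination (`ElimDataW`) and
for constant substitutions.

## References

* J. Li, T. Yang, *3.1n − o(n) circuit lower bounds for explicit functions*, STOC 2022;
  ECCC TR21-023, §4.1 (before Case 6; Cases 6.2, 6.2.1, 6.2.2), Def. 3.1, Lemma 3.11.
-/

namespace Literature.Computability.Complexity

open Finset

namespace Semicircuit

variable {n : ℕ} {C : Semicircuit n} {f : (Fin n → ZMod 2) → Bool} {R : RdqSource n} {αφ αI αQ : ℝ}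

/-- **No ∧-type gate is fed by two variables** ("From now on, no ∧-type gate is directly fed by
two variables", the standing assumption from Case 6 on). [cite: LiYang2022, §4.1 (before Case 6)] -/
def NoAndTwoVars (C : Semicircuit n) : Prop :=
  ∀ (G : Fin C.m) (a : Fin 2) (x y : Fin n), IsAndOp (C.op G) → C.arg G a = .var x → C.arg G a.rev = .var y → False

/-- Under `NoAndTwoVars` there is no troubled gate at all (a troubled gate is ∧-type fed by two
variables). [cite: LiYang2022, §4.1 (before Case 6), Def. 3.1] -/
theorem not_troubled_of_noAndTwoVars (h : C.NoAndTwoVars) (G : Fin C.m) : ¬ C.Troubled G := by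
  intro hT
  obtain ⟨hand, -, x, y, p, -, hx, hy, -, -⟩ := Troubled.exists_wires hT
  exact h G p x y hand hx hy

/-- `NoAndTwoVars` survives a constant substitution (wires only turn into constants). [folklore] -/
theorem NoAndTwoVars.substConst (h : C.NoAndTwoVars) (j : Fin n) (b : Bool) : (C.substConst j b).NoAndTwoVars := by
  intro G a x y hand hx hy
  have hx' := Node.substConst_eq_var_iff.mp hx
  have hy' := Node.substConst_eq_var_iff.mp hy
  exact h G a x y hand hx'.1 hy'.1

/-- `NoAndTwoVars` survives an affine substitution `x_j := x_k ⊕ c` at gates not reading `x_j`;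
in general a gate reading `x_j` and a variable afterwards read two variables before. [folklore] -/
theorem NoAndTwoVars.substVar (h : C.NoAndTwoVars) (j k : Fin n) (c : Bool) : (C.substVar j k c).NoAndTwoVars := by
  intro G a x y hand hx hy
  rw [isAndOp_substVar_iff] at hand
  have key : ∀ {a' : Fin 2} {z : Fin n}, (C.substVar j k c).arg G a' = .var z → ∃ z', C.arg G a' = .var z' := by
    intro a' z hz
    change (C.arg G a').substVar j k = .var z at hz
    cases h' : C.arg G a' with
    | const b => rw [h'] at hz; cases hz
    | var i => exact ⟨i, rfl⟩
    | gate g => rw [h'] at hz; exact absurd hz (by rw [Node.substVar_of_ne (by simp) k]; simp)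
  obtain ⟨x', hx'⟩ := key hx
  obtain ⟨y', hy'⟩ := key hy
  exact h G a x' y' hand hx' hy'

/-- **A troubled gate after an exact elimination, when before it no ∧-type gate was fed by two
variables**: it read the eliminated gate `k₀` at some position, the replacement node is a
variable `u` (now read there), and its other wire is an untouched variable `t ≠ u`
(Li–Yang Case 6.2: the live input `R` of the bypassed gate "is either an ∧-type gate or a
variable"; an ∧-type gate cannot become troubled; "`R = u` is a variable … `B` is an ∧-type gate
fed by `P` and a variable `t`"). [cite: LiYang2022, §4.1 (Cases 6.2, 6.2.1, 6.2.2)] -/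
theorem ElimDataW.exists_of_troubled_noAndTwoVars {k₀ : Fin C.m} {P : Finset (Fin C.m × Fin C.m)} {δ : ℝ}
    (E : ElimDataW C k₀ f R αφ αI αQ P δ) (h2 : C.NoAndTwoVars) {T : Fin E.C'.m} (hT : E.C'.Troubled T) :
    ∃ (a : Fin 2) (u t : Fin n), C.arg (E.ι T) a = .gate k₀ ∧ E.repl = .var u ∧ E.C'.arg T a = .var u ∧
      C.arg (E.ι T) a.rev = .var t ∧ E.C'.arg T a.rev = .var t ∧ t ≠ u := by
  obtain ⟨hand', -, x0, x1, p, hne, hx0, hx1, -, -⟩ := Troubled.exists_wires hT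
  have hand : IsAndOp (C.op (E.ι T)) := (E.isAndOp_iff T).mp hand'
  have h0 := (E.arg_eq_var_iff T p x0).mp hx0
  have h1 := (E.arg_eq_var_iff T p.rev x1).mp hx1
  rcases h0 with h0 | ⟨h0, hr0⟩
  · rcases h1 with h1 | ⟨h1, hr1⟩
    · exact (h2 (E.ι T) p x0 x1 hand h0 h1).elim
    · refine ⟨p.rev, x1, x0, h1, hr1, hx1, ?_, ?_, hne⟩
      · rw [Fin.rev_rev]; exact h0
      · rw [Fin.rev_rev]; exact hx0
  · rcases h1 with h1 | ⟨-, hr1⟩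
    · exact ⟨p, x0, x1, h0, hr0, hx0, h1, hx1, fun h => hne h.symm⟩
    · -- both wires went to `k₀`: then both now read the variable `repl`, so `x0 = x1` — impossible
      exfalso
      rw [hr0] at hr1
      exact hne (Node.var.inj hr1)

/-- In particular the eliminated gate's replacement is a variable of out-degree `2` afterwards and
the troubled gate is one of its two readers. [cite: LiYang2022, §4.1 (Case 6.2.2)] -/
theorem ElimDataW.fanout_repl_of_troubled_noAndTwoVars {k₀ : Fin C.m} {P : Finset (Fin C.m × Fin C.m)} {δ : ℝ}
    (E : ElimDataW C k₀ f R αφ αI αQ P δ) (h2 : C.NoAndTwoVars) {T : Fin E.C'.m} (hT : E.C'.Troubled T) :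
    ∃ u, E.repl = .var u ∧ E.C'.fanout (.var u) = 2 := by
  obtain ⟨a, u, t, -, hr, ha, -, -, -⟩ := E.exists_of_troubled_noAndTwoVars h2 hT
  obtain ⟨-, -, -, -, -, h2u, -⟩ := Troubled.exists_wires_of_reads hT ⟨a, ha⟩
  exact ⟨u, hr, h2u⟩

end Semicircuit

end Literature.Computability.Complexity
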